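import Literature.AlgebraicGeometry.Motives.SurfaceNet
import Literature.AlgebraicGeometry.Motives.FiberNetProduct
import Literature.AlgebraicGeometry.Motives.AbelianVarietyProofs
import Literature.AlgebraicGeometry.Motives.VarietiesRegularProofs
import Literature.AlgebraicGeometry.Motives.VarietiesDimensionProofs
import Literature.AlgebraicGeometry.Motives.VarietiesGeometricallyIntegralProofs
import Literature.AlgebraicGeometry.Motives.VarietiesProjectiveSpaceProofs
import Literature.AlgebraicGeometry.Motives.VarietiesProperProofs
import Literature.AlgebraicGeometry.Motives.GoodReductionSpecialFibreProofs
import Literature.AlgebraicGeometry.Resolution.AlterationsFibresConnectedHolds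
import Literature.AlgebraicGeometry.Resolution.AlterationsLemma411Vertex
import Literature.AlgebraicGeometry.Resolution.AlterationsLemma411VertexBlowupHolds
import Literature.AlgebraicGeometry.Resolution.AlterationsLemma411Blowup
import Literature.AlgebraicGeometry.Resolution.AlterationsLemma411FibreDimension
import Literature.AlgebraicGeometry.Resolution.AlterationsLemma411SmoothLocus
import Literature.AlgebraicGeometry.Resolution.Lemma411VertexChoiceHolds
import Literature.AlgebraicGeometry.Resolution.ProjectiveSpaceSimplyConnectedHolds
import Literature.AlgebraicGeometry.Resolution.AlterationsBlowupDivisorProofs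
import Literature.AlgebraicGeometry.Resolution.BlowupRegularPoints
import Literature.AlgebraicGeometry.Resolution.RegularLocalRingsNormal
import Literature.AlgebraicGeometry.Resolution.SmoothOfRegularPerfectField
import Literature.AlgebraicGeometry.Morphisms.SteinFactorizationConnectedFibres
import HarnessLib

/-!
# Curve nets from de Jong's Lemma 4.11: every smooth projective variety over an algebraically
closed field carries a curve net

Topic `Literature/AlgebraicGeometry/Motives`. Pure proofs, no named facts. This file discharges
the construction half of the named facts `Motives.nonempty_curveNet` (`Motives/CurveNetExistence`)
and, downstream, `Motives.exists_fiberNet_smoothBase_nonempty` (`Motives/FiberNetExistence`):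
for a smooth projective geometrically irreducible variety `X` of dimension `m + 1` over an
ALGEBRAICALLY CLOSED field `k`, the type `CurveNet m X` (`Motives/CurveNet`) is non-empty
(`nonempty_curveNet_of_isAlgClosed`).

The printed source behind `nonempty_curveNet` (Hartshorne II Example 7.17.3 + II Thm. 8.18 +
the connectedness theorem) constructs the net by a generic linear projection and the blow-up of
its (finite) base locus. Exactly this construction is carried out — for an arbitrary projective
variety, and with every step PROVED in the tree — by de Jong 1996, Lemma 4.11 and 4.12
(`Resolution/AlterationsLemma411*`, `Resolution/AlterationsFibresConnected*`):

> "4.11. Lemma. — […] There exist a modification `φ : X' → X` and a morphism `f : X' → ℙ^{d-1}`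
> of varieties having the following properties: (i) There exists a finite subset `S ⊂ Reg(X)`,
> consisting of closed points, disjoint from `Z`, such that `φ : X' → X` is equal to the blowing
> up of `X` in `S`. (ii) a) All fibres of `f` are equidimensional of dimension 1 and nonempty.
> […] d) At least one fibre of `f` is smooth." — "4.12. […] We conclude that `Y' = ℙ^{d-1}`,
> hence all fibres of `f` are geometrically connected."

(the projection is from a general linear centre after a finite generic projection `X → ℙ^d`,
p. 68: "`X' = {(x, ℓ) ∈ X × ℙ^{d-1} | π(x) ∈ ℓ}` […] equals the blowing up of `X` in the finite
set `π⁻¹(p)`"). All the named facts into which the tree cut 4.11–4.12 are discharged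
(`DeJong1996Lemma411VertexChoice_holds`, `DeJong1996VertexBlowupProjection_holds`,
`DeJong1996Lemma411Blowup_holds`, `DeJong1996Lemma411FibreDimension_holds`,
`DeJong1996Lemma411SmoothLocusDense_holds`, `DeJong1996SteinFactorizationEtale_holds`,
`ProjectiveSpaceSimplyConnected_holds`, `steinFactorization_geometricallyConnected_holds`), so
here we only ASSEMBLE:

* `dejong_lemma411` / `dejong_fibresGeometricallyConnected` — Lemma 4.11 and the geometric
  connectedness of 4.12, unconditionally;
* `GeometricallyConnected.comp_of_universallyClosed` — a universally closed morphism with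
  geometrically connected fibres followed by a morphism with geometrically connected fibres has
  geometrically connected fibres (Stacks 0377 for closed quotient maps; Mathlib has the
  universally-open variant `GeometricallyConnected.comp`);
* `smoothOfRelativeDimension_morphismRestrict_of_smoothOfRelativeDimension_hom` — relative
  dimension bookkeeping: a `k`-morphism `T → ℙᵐ_k` from a `k`-scheme smooth of relative
  dimension `m + r` is smooth of relative dimension `r` wherever it is smooth;
* `nonempty_curveNet_of_isAlgClosed` — for `X` smooth projective of dimension `m + 1` over an
  algebraically closed field (with `Z = ∅`, the unit ideal being an effective Cartier divisor),
  Lemma 4.11 gives `φ : X' → X`, the blowing up in a finite set `S` of closed points, and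
  `f : X' → ℙᵐ_k`; `X'` is regular (`IsBlowup.isRegularLocalRing_stalk_of_finite`, Liu 8.1.19 (a),
  and `φ` is a local isomorphism off `S`), hence smooth over the perfect field `k`
  (`Resolution.smooth_of_isRegular_of_perfectField`, Matsumura §30 Rem. 2), of relative
  dimension `m + 1` (it contains the non-empty open `φ⁻¹(X ∖ S) ≅ X ∖ S`), projective
  (`BlowupProjectiveOverField_holds`, Hartshorne II 7.16 (c)) and geometrically irreducible
  (smooth and geometrically connected, `X' → ℙᵐ → Spec k`); `φ` is an isomorphism off `S`
  (`IsBlowup.isIso_compl`, Stacks 02OS) and `S ≠ X`; `f` has geometrically connected fibres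
  (4.12). These are the fields of `CurveNet m X`.

## References

* A. J. de Jong, *Smoothness, semi-stability and alterations*, Publ. Math. IHÉS 83 (1996),
  Lemma 4.11 and 4.12, pp. 67–69. [DeJong1996]
* R. Hartshorne, *Algebraic Geometry* (1977), II Example 7.17.3, II Prop. 7.16 (c), II Thm. 8.18,
  III Cor. 11.3. [Hartshorne1977]
* The Stacks Project, Tags 0377, 02OS, 03H2. [StacksProject]
-/

noncomputable section

open CategoryTheory CategoryTheory.Limits AlgebraicGeometry TopologicalSpace

universe u

namespace Literature.AlgebraicGeometry.Motives

open Literature.AlgebraicGeometry.Resolution Literature.AlgebraicGeometry.Morphisms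

/-! ## De Jong 1996, Lemma 4.11 and 4.12, unconditionally -/

/-- **de Jong 1996, Lemma 4.11**, assembled from the discharged leaves of the tree
(`DeJong1996Lemma411.of_vertexBlowupProjection_of_vertexChoice_of_construction`).
[cite: DeJong1996, Lemma 4.11, pp. 67–68] -/
theorem dejong_lemma411 : DeJong1996Lemma411.{u} :=
  DeJong1996Lemma411.of_vertexBlowupProjection_of_vertexChoice_of_construction
    DeJong1996VertexBlowupProjection_holds DeJong1996Lemma411VertexChoice_holds
    DeJong1996Lemma411Blowup_holds DeJong1996Lemma411FibreDimension_holds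
    DeJong1996Lemma411SmoothLocusDense_holds

/-- **de Jong 1996, 4.12: all fibres of `f` are geometrically connected**, assembled from
Zariski's connectedness theorem (Stacks 03H2 (1)), the étaleness of the Stein finite part and
`π₁(ℙ^d) = 0` (`DeJong1996FibresGeometricallyConnected.of_steinEtale_of_simplyConnected`).
[cite: DeJong1996, 4.12, pp. 68–69] -/
theorem dejong_fibresGeometricallyConnected : DeJong1996FibresGeometricallyConnected.{u} :=
  DeJong1996FibresGeometricallyConnected.of_steinEtale_of_simplyConnected
    steinFactorization_geometricallyConnected_holds DeJong1996SteinFactorizationEtale_holds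
    ProjectiveSpaceSimplyConnected_holds

/-! ## Geometric connectedness of composites with a universally closed first factor -/

/-- If `f : X → S` is a closed map with (geometrically) connected fibres and `S` is connected,
then `X` is connected: a closed continuous surjection is a quotient map, and a quotient map with
connected fibres pulls connected closed sets back to connected sets (Stacks 0377).
[cite: StacksProject, Tag 0377] -/
theorem _root_.AlgebraicGeometry.GeometricallyConnected.connectedSpace_of_isClosedMap
    {X S : Scheme.{u}} (f : X ⟶ S) [GeometricallyConnected f] [ConnectedSpace S]
    (hf : IsClosedMap f.base) : ConnectedSpace X := by
  have hq : Topology.IsQuotientMap f.base := hf.isQuotientMap f.continuous f.surjective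
  have h := hq.isCoinducing.isConnected_preimage_of_isClosed f.isConnected_preimage_singleton
    isClosed_univ isConnected_univ
  rw [Set.preimage_univ] at h
  exact connectedSpace_iff_univ.mpr h

/-- **A universally closed morphism with geometrically connected fibres, followed by a morphism
with geometrically connected fibres, has geometrically connected fibres**: after base change to
`Spec K → Z` the composite is `X_K → Y_K → Spec K` with `Y_K` connected and `X_K → Y_K` a closed
surjection with connected fibres (Stacks 0377; Mathlib's `GeometricallyConnected.comp` is the
universally open variant). [cite: StacksProject, Tag 0377] -/
theorem _root_.AlgebraicGeometry.GeometricallyConnected.comp_of_universallyClosed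
    {X Y Z : Scheme.{u}} (f : X ⟶ Y) (g : Y ⟶ Z) [GeometricallyConnected f]
    [UniversallyClosed f] [GeometricallyConnected g] : GeometricallyConnected (f ≫ g) := by
  refine ⟨geometrically_iff_of_isClosedUnderIsomorphisms.mpr fun K _ x ↦ ?_⟩
  rw [← (pullbackRightPullbackFstIso g x f).hom.homeomorph.connectedSpace_iff]
  haveI : ConnectedSpace ↥(pullback g x) :=
    pullback_of_geometrically GeometricallyConnected.geometrically_connectedSpace K x
  exact GeometricallyConnected.connectedSpace_of_isClosedMap
    (pullback.snd f (pullback.fst g x)) (pullback.snd f (pullback.fst g x)).isClosedMap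

/-- A `k`-scheme with a universally closed `k`-morphism with geometrically connected fibres to
`ℙᵐ_k` is geometrically connected over `k` (`ℙᵐ_k` is geometrically irreducible, hence
geometrically connected, over `k`). [folklore] -/
theorem geometricallyConnected_hom_of_geometricallyConnected_toProjectiveSpace {k : Type u}
    [Field k] {m : ℕ} {T : SchemeOver k} (π : T ⟶ projectiveSpace m k)
    [GeometricallyConnected π.left] [UniversallyClosed π.left] : GeometricallyConnected T.hom := by
  haveI := (isSmoothProjective_projectiveSpace_holds k m).geometricallyIrreducible
  haveI : GeometricallyConnected (projectiveSpace m k).hom :=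
    geometricallyConnected_of_geometricallyIrreducible _
  rw [← Over.w π]
  exact GeometricallyConnected.comp_of_universallyClosed _ _

/-! ## Relative dimension bookkeeping over `ℙᵐ` -/

/-- **Relative dimension bookkeeping.** Let `T` be a `k`-scheme smooth of relative dimension
`m + r` over `k` and `π : T → ℙᵐ_k` a `k`-morphism. If `π` is smooth over an open `U ⊆ ℙᵐ`, then
`π|_U` is smooth of relative dimension `r`: around each point of `π⁻¹U` the smooth `π|_U` is
smooth of SOME relative dimension `d` on an open `V` (Görtz–Wedhorn I, Prop. 6.15 (1));
`V ↪ π⁻¹U → U ↪ ℙᵐ → Spec k` is then smooth of relative dimension `d + m` and equals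
`V ↪ T → Spec k`, smooth of relative dimension `m + r`, and the relative dimension of a smooth
morphism with non-empty source is unique (`AbelianVarietyProofs.eq_of_smoothOfRelativeDimension`).
(The same statement for `IsSmoothProjective (m + r) T` is
`Motives.smoothOfRelativeDimension_morphismRestrict_of_isSmoothProjective` of
`Motives/FiberNetExistence`, which this file must not import.)
[cite: GortzWedhorn2020, Def. 6.14, Prop. 6.15 (1) and Lemma 6.26] -/
theorem smoothOfRelativeDimension_morphismRestrict_of_smoothOfRelativeDimension_hom {k : Type u}
    [Field k] {r m : ℕ} {T : SchemeOver k} [SmoothOfRelativeDimension (m + r) T.hom]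
    (π : T ⟶ projectiveSpace m k) (U : (projectiveSpace m k).left.Opens)
    (hU : Smooth (π.left ∣_ U)) : SmoothOfRelativeDimension r (π.left ∣_ U) := by
  haveI := hU
  haveI : SmoothOfRelativeDimension m (projectiveSpace m k).hom :=
    (isSmoothProjective_projectiveSpace_holds k m).smoothOfRelativeDimension
  choose V d hxV hV using exists_opens_smoothOfRelativeDimension_of_smooth (π.left ∣_ U)
  have hd : ∀ x, d x = r := by
    intro x
    haveI := hV x
    haveI : Nonempty ((V x : Scheme.{u})) := ⟨(⟨x, hxV x⟩ : V x)⟩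
    have h₁ : SmoothOfRelativeDimension (d x + (0 + m))
        (((V x).ι ≫ π.left ∣_ U) ≫ U.ι ≫ (projectiveSpace m k).hom) := inferInstance
    have heq : ((V x).ι ≫ π.left ∣_ U) ≫ U.ι ≫ (projectiveSpace m k).hom =
        (V x).ι ≫ (π.left ⁻¹ᵁ U).ι ≫ T.hom := by
      rw [Category.assoc, ← Category.assoc (π.left ∣_ U), morphismRestrict_ι, Category.assoc,
        Over.w π]
    have h₂ : SmoothOfRelativeDimension (0 + (0 + (m + r)))
        ((V x).ι ≫ (π.left ⁻¹ᵁ U).ι ≫ T.hom) := inferInstance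
    rw [heq] at h₁
    have := AbelianVarietyProofs.eq_of_smoothOfRelativeDimension _ h₁ h₂
    omega
  have hcov : iSup V = ⊤ := by
    rw [eq_top_iff]
    rintro x -
    exact TopologicalSpace.Opens.mem_iSup.mpr ⟨x, hxV x⟩
  exact IsZariskiLocalAtSource.of_iSup_eq_top (P := @SmoothOfRelativeDimension r) V hcov
    fun x => hd x ▸ hV x

/-! ## Regularity of the blowing up of a regular scheme in finitely many closed points -/

/-- **The blowing up of a regular locally Noetherian scheme in a finite set of closed points is
regular**: over the centre by Liu 8.1.19 (a) (`IsBlowup.isRegularLocalRing_stalk_of_finite`), and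
off the centre the blowing up is a local isomorphism (`IsBlowup.isOpenImmersion_preimage_compl_ι`).
[cite: Liu2002, Thm. 8.1.19 (a)] -/
theorem isRegular_of_isBlowup_finite {X X' : Scheme.{u}} [IsLocallyNoetherian X]
    (hreg : ∀ x : X, IsRegularLocalRing (X.presheaf.stalk x)) {S : Set X} (hS : IsClosed S)
    (hSf : S.Finite) (hSc : ∀ s ∈ S, IsClosed ({s} : Set X)) {π : X' ⟶ X}
    (hπ : IsBlowup π (Scheme.IdealSheafData.vanishingIdeal ⟨S, hS⟩)) (x' : X') :
    IsRegularLocalRing (X'.presheaf.stalk x') := by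
  by_cases hx : π x' ∈ S
  · have hRo : IsOpen (Scheme.regularLocus X) := by
      have : Scheme.regularLocus X = Set.univ := Set.eq_univ_of_forall fun x => hreg x
      rw [this]
      exact isOpen_univ
    exact hπ.isRegularLocalRing_stalk_of_finite hRo hS hSf hSc (fun x _ => hreg x) hx
  · -- off the centre `π` is a local isomorphism
    set U : X'.Opens := π ⁻¹ᵁ centreCompl (Scheme.IdealSheafData.vanishingIdeal ⟨S, hS⟩) with hU
    have hx' : x' ∈ U := by
      rw [hU]
      change π x' ∈
        ((Scheme.IdealSheafData.vanishingIdeal (⟨S, hS⟩ : Closeds X)).support : Set X)ᶜ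
      rw [Scheme.IdealSheafData.coe_support_vanishingIdeal]
      exact hx
    haveI hoi : IsOpenImmersion (U.ι ≫ π) := by
      rw [hU]
      exact hπ.isOpenImmersion_preimage_compl_ι
    have h2 : IsIso (π.stalkMap x' ≫ U.ι.stalkMap ⟨x', hx'⟩) := by
      have h3 : IsIso ((U.ι ≫ π).stalkMap ⟨x', hx'⟩) := inferInstance
      rw [Scheme.Hom.stalkMap_comp] at h3
      exact h3
    have h4 : IsIso (U.ι.stalkMap ⟨x', hx'⟩) := inferInstance
    haveI : IsIso (π.stalkMap x') :=
      @IsIso.of_isIso_comp_right _ _ _ _ _ (π.stalkMap x') (U.ι.stalkMap ⟨x', hx'⟩) h4 h2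
    haveI := hreg (π x')
    exact IsRegularLocalRing.of_ringEquiv (asIso (π.stalkMap x')).commRingCatIsoToRingEquiv

/-! ## Curve nets over algebraically closed fields -/

/-- `Over.mk X.hom` is `X` (definitional `η` for the comma object). [folklore] -/
theorem over_mk_hom {k : Type u} [Field k] (X : SchemeOver k) : Over.mk X.hom = X := rfl

/-- **Every smooth projective variety of dimension `m + 1` over an algebraically closed field
carries a curve net over `ℙᵐ`** (`Motives.CurveNet m X`): de Jong 1996, Lemma 4.11 (with
`Z = ∅`) provides the blowing up `φ : X' → X` of `X` in a finite set `S` of closed points and a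
`k`-morphism `f : X' → ℙᵐ_k`, all of whose fibres are geometrically connected by 4.12; `X'` is a
smooth projective geometrically irreducible `(m + 1)`-fold, and `φ` is an isomorphism off
`S ≠ X` (module docstring). The classical source of the same construction is Hartshorne II
Example 7.17.3 with II Thm. 8.18 (and the connectedness theorem, Hartshorne III Cor. 11.3).
[cite: DeJong1996, Lemma 4.11 and 4.12, pp. 67–69]
[cite: Hartshorne1977, II Example 7.17.3 and II Thm. 8.18] -/
theorem nonempty_curveNet_of_isAlgClosed {k : Type u} [Field k] [IsAlgClosed k] {m : ℕ}
    {X : SchemeOver k} (hX : IsSmoothProjective (m + 1) X) : Nonempty (CurveNet m X) := by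
  classical
  -- the hypotheses (i)–(v) of 4.11/4.12 for the pair `(X, ∅)`
  haveI hint : IsIntegral X.left := IsSmoothProjective.isIntegral_holds hX
  have hproj : IsProjectiveOver (Over.mk X.hom) := hX.isProjectiveOver
  haveI := hX.smoothOfRelativeDimension
  haveI := hX.geometricallyIrreducible
  haveI : IrreducibleSpace X.left := GeometricallyIrreducible.irreducibleSpace_of_subsingleton X.hom
  have hreg : ∀ x : X.left, IsRegularLocalRing (X.left.presheaf.stalk x) := fun x =>
    isRegularLocalRing_stalk_of_smoothOfRelativeDimension X.hom (m + 1) x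
  have hdim : topologicalKrullDim X.left = (m + 1 : ℕ) :=
    topologicalKrullDim_eq_of_smoothOfRelativeDimension X.hom (m + 1)
  have hZ : ∃ D : X.left.IdealSheafData, IsEffectiveCartier D ∧ (D.support : Set X.left) = ∅ :=
    ⟨⊤, isEffectiveCartier_top, by simp⟩
  have hP : DeJong1996.NormalProjectivePair X.hom (∅ : Set X.left) :=
    ⟨hint, hproj, hZ, fun x => isIntegrallyClosed_of_isRegularLocalRing _⟩
  -- Lemma 4.11 with d), and 4.12
  obtain ⟨-, h⟩ := dejong_lemma411 k X.left X.hom ∅ m hint hproj hZ hdim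
  obtain ⟨X', φ, f, hF, hy⟩ := h hP.isIntegrallyClosed
  haveI hgc : GeometricallyConnected f :=
    dejong_fibresGeometricallyConnected k X.left X.hom ∅ m X' φ f hP hdim hF hy
  haveI : IsProper f := hF.isProper hP hdim
  haveI hint' : IsIntegral X' := (hF.isAlteration hP hdim).isIntegral
  haveI : IsProper φ := (hF.isAlteration hP hdim).isProper
  obtain ⟨S, hS, hSf, hSc, -, -, hblow⟩ := hF.exists_isBlowup
  set J := Scheme.IdealSheafData.vanishingIdeal (⟨S, hS⟩ : Closeds X.left) with hJ
  have h1 : (1 : WithBot ℕ∞) ≤ topologicalKrullDim X.left := by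
    rw [hdim]
    exact_mod_cast Nat.succ_le_succ (Nat.zero_le m)
  have hJne : J ≠ ⊥ := vanishingIdeal_ne_bot_of_forall_isClosed h1 hS hSc
  -- the total space over `k`, the blow-down and the projection as `k`-morphisms
  let T : SchemeOver k := Over.mk (φ ≫ X.hom)
  let σ : T ⟶ X := Over.homMk φ rfl
  let π : T ⟶ projectiveSpace m k := Over.homMk f hF.comp_hom
  -- `X'` is regular, hence smooth over the perfect field `k`, of relative dimension `m + 1`
  haveI : Smooth X.hom := SmoothOfRelativeDimension.smooth (m + 1) X.hom
  haveI : LocallyOfFiniteType X.hom := inferInstance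
  haveI : IsLocallyNoetherian X.left := LocallyOfFiniteType.isLocallyNoetherian X.hom
  have hreg' : ∀ x' : X', IsRegularLocalRing (X'.presheaf.stalk x') :=
    isRegular_of_isBlowup_finite hreg hS hSf hSc hblow
  haveI : LocallyOfFiniteType (φ ≫ X.hom) := inferInstance
  haveI hsm : Smooth (φ ≫ X.hom) := smooth_of_isRegular_of_perfectField (φ ≫ X.hom) hreg'
  obtain ⟨n, hn⟩ := exists_smoothOfRelativeDimension_of_smooth (φ ≫ X.hom)
  have hnm : n = m + 1 := by
    haveI := hn
    let V : X'.Opens := φ ⁻¹ᵁ centreCompl J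
    haveI hoi : IsOpenImmersion (V.ι ≫ φ) := hblow.isOpenImmersion_preimage_compl_ι
    haveI : IsIso (φ ∣_ centreCompl J) := hblow.isIso_compl
    obtain ⟨x, hx⟩ := centreCompl_nonempty (J := J) hJne
    haveI : Nonempty (V : Scheme.{u}) := ⟨((asIso (φ ∣_ centreCompl J)).inv ⟨x, hx⟩ : _)⟩
    have h₁ : SmoothOfRelativeDimension n (V.ι ≫ φ ≫ X.hom) := IsZariskiLocalAtSource.comp hn _
    have h₂ : SmoothOfRelativeDimension (0 + (m + 1)) ((V.ι ≫ φ) ≫ X.hom) := inferInstance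
    rw [Category.assoc] at h₂
    have := AbelianVarietyProofs.eq_of_smoothOfRelativeDimension _ h₁ h₂
    omega
  haveI hTsm : SmoothOfRelativeDimension (m + 1) (φ ≫ X.hom) := hnm ▸ hn
  -- `X'` is projective (Hartshorne II 7.16 (c)) and geometrically irreducible
  have hTproj : IsProjectiveOver T :=
    BlowupProjectiveOverField_holds k X.left X' X.hom J φ hint hproj hJne hblow
  haveI : GeometricallyConnected π.left := hgc
  haveI : UniversallyClosed π.left := inferInstanceAs (UniversallyClosed f)
  haveI : GeometricallyConnected T.hom :=
    geometricallyConnected_hom_of_geometricallyConnected_toProjectiveSpace π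
  haveI : SmoothOfRelativeDimension (m + 1) T.hom := hTsm
  have hT : IsSmoothProjective (m + 1) T :=
    ⟨hTsm, hTproj,
      geometricallyIrreducible_of_geometricallyConnected_of_smoothOfRelativeDimension T.hom (m + 1)⟩
  -- the base locus `S ⊊ X` and the isomorphism off it
  have hSne : S ≠ Set.univ := by
    obtain ⟨x, hx⟩ := centreCompl_nonempty (J := J) hJne
    intro hSu
    apply hx
    rw [hJ, Scheme.IdealSheafData.coe_support_vanishingIdeal]
    exact hSu ▸ Set.mem_univ x
  have hopens : (⟨Sᶜ, hS.isOpen_compl⟩ : X.left.Opens) = centreCompl J := by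
    ext x
    change x ∈ Sᶜ ↔ x ∈ ((J.support : Set X.left))ᶜ
    rw [hJ, Scheme.IdealSheafData.coe_support_vanishingIdeal]
    rfl
  have hiso : IsIso (σ.left ∣_ (⟨Sᶜ, hS.isOpen_compl⟩ : X.left.Opens)) := by
    rw [hopens]
    exact hblow.isIso_compl
  exact ⟨{ total := T
           isSmoothProjective_total := hT
           blowDown := σ
           baseLocus := S
           isClosed_baseLocus := hS
           baseLocus_ne_univ := hSne
           isIso_blowDown_restrict := hiso
           proj := π
           geometricallyConnected_proj := hgc
           smoothOfRelativeDimension_one := fun U hU =>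
             smoothOfRelativeDimension_morphismRestrict_of_smoothOfRelativeDimension_hom π U hU }⟩

/-- The same, as a net of `1`-folds (`FiberNet 1 m X`, `Motives/SurfaceNet`). [folklore] -/
theorem nonempty_fiberNet_one_of_isAlgClosed {k : Type u} [Field k] [IsAlgClosed k] {m : ℕ}
    {X : SchemeOver k} (hX : IsSmoothProjective (m + 1) X) : Nonempty (FiberNet 1 m X) := by
  obtain ⟨N⟩ := nonempty_curveNet_of_isAlgClosed hX
  exact ⟨N.toFiberNet⟩

end Literature.AlgebraicGeometry.Motives

end
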